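import Summits.BirchSwinnertonDyer.Rank1Residual.X11b.BDPRouteOnTreeStepL
import HarnessLib

/-!
# Rank ONE at a GOOD ORDINARY prime, one level below STEP L: the anticyclotomic main conjecture
# (one divisibility, composed with the BDP formula) and the anticyclotomic control theorem AS TYPED
# ON THE TREE'S CONSTRUCTED `X_ac`, and the deduction (IMC≥∘BDP)ᵍ + (CTL)ᵍ ⇒ STEP L
# (cell `b2b-bsdres`, GLUE seat gen 3; the good-`p` twin of multr1's `X11b/AnticyclotomicLowerLinks*.lean`)

HONEST FRAMING (cell `b2b-bsdres`, run/shared/lean/b2b/bsd-rank1-residual/, verbatim in every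
file): the goal of the cell is to DELETE the COMBINATION-SHAPED residual classes of the
Birch–Swinnerton-Dyer formula for ALL analytic-rank `≤ 1` elliptic curves over `ℚ` — "full BSD
formula for every rank `≤ 1` curve in class `C`" assembled STRICTLY from published theorems — so
that the rank-`≤ 1` remainder becomes exactly the CONSTRUCTION-SHAPED classes, which are TYPED
(missing-input `Prop`s), NOT attempted. This is not "finishing BSD". Research routes; no claim
beyond the stated classes; nothing booked; no label changes. Unit `b2b-bsdres-lit-glue` (GLUE seat:
"main conjecture (as typed) + control theorems (as typed) ⇒ BSD_p"), gen 3 = sized ask A4 of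
`HOME/b2b-bsdres-lit-glue/GLUE.md` §G2.4. DEFINITIONS (three `Prop`-valued predicates WITH
PARAMETERS naming printed SHAPES on constructed objects — nothing asserted, no named fact, no
`sorry`) and THEOREMS.

## Why this file

The covered rank-one rows C2 (Burungale–Castella–Skinner 2025 Cor. 1.3.1), C3 (Jetchev–Skinner–Wan
2017 Thm. 1.2.1, ordinary part) and C16 (Yan–Zhu 2026 Thm. 4.15) point, at main-conjecture level, at the
kernel objects of `Partition/MainConjecturesIrreducibleClass.lean` (gen 2), whose ONE typed input is
STEP L = `X11b.IndexLowerBoundAt W p K P` (`2·ord_p[E(K):ℤP_K] ≤ ord_p #Ш(E/K) + 2·ord_p ∏_ℓ c_ℓ(E)`,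
JSW17 (eq:shalowerK-1)) — the OUTPUT of "anticyclotomic main conjecture (one divisibility) + BDP
`p`-adic Waldspurger formula + anticyclotomic control theorem" (BCS Cor. 1.3.1's printed proof, p. 4:
"Theorem 1.2.4, the `p`-adic Waldspurger formula [BDP13] …, the anticyclotomic control theorem [JSW17,
Thm. 3.3.1], and the `r = 0` result for the `K`-quadratic twist of `E`"). For a MULTIPLICATIVE `p` the
sibling sub-cell multr1 typed the two antecedents of STEP L on CONSTRUCTED objects — the `Λ`-dual
`X_ac(E[p^∞]) = AcSelmer.XAc (E_K) p κ 𝔭 ∅ γ` of Castella's `Sel_𝔭(K_∞, E[p^∞])` (Cas18 Def. 2.2; at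
the primes above `p`: strict at `𝔭`, relaxed at `𝔭̄` — the definition does not see the reduction type
at `p`), `ord_p log_{ω_E} P = padicLogOrd W p ι P` through THE embedding `embAt K p 𝔭 : K ↪ K_𝔭 = ℚ_p`,
`∏_{w∣N⁺} c_w(E/K) = tamagawaProductSplit W K` — as `ControlOnTreeAt` (Cas18 Thm. 2.3 with `ε_p = 0`)
and `IMCLowerWaldspurgerOnTreeAt` ((IMC≥) ∘ Cas18 Thm. 3.2 with `ε_p = 0`), and proved (IMC≥∘BDP)ᵗ +
(CTL)ᵗ ⇒ `IndexLowerBoundAt` (`X11b/AnticyclotomicLowerLinks{,Heegner}.lean`, `BDPRouteOnTreeStepL.lean`).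
Castella prints BOTH theorems for BOTH cases — "where `ε_p = p⁻¹` if `p ∤ N` and `ε_p = 0` otherwise"
(Thm. 2.3, arXiv:1704.06608 p. 5; Thm. 3.2, p. 9) — so at a GOOD ordinary `p` split in `K` the same
two links read, in valuations (`ord_p(1 − a_p p⁻¹ + p⁻¹) = ord_p(1 − a_p + p) − 1`):

* **(CTL)ᵍ `ControlOnTreeGoodAt p κ 𝔭 γ ι P`** — Cas18 Thm. 2.3 with `ε_p = p⁻¹` (⇐ JSW17 Thm. 3.3.1,
  stated there for any level `N`; the local term at `v ∣ p` is `#ℤ_p/(((1−a_p+p)/p)·log_{ω_E} P)/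
  [E(K):ℤP]_p`, JSW17 §3.5 p. 16), `Σ = ∅`: `X_ac` is `Λ`-torsion with a generator `f`, `f(0) ≠ 0`,
  `ord_p f(0) = ord_p #Ш(E/K)[p^∞] + 2·((ord_p log_ω P + ord_p(1 − a_p + p) − 1) − ord_p[E(K):ℤP]) +
  ord_p ∏_{w∣N⁺} c_w(E/K)` — PUBLISHED SHAPE, every symbol a tree object;
* **(IMC≥∘BDP)ᵍ `IMCLowerWaldspurgerOnTreeGoodAt p κ 𝔭 γ ι P`** — the one-sided divisibility
  "`Ch_Λ(X_ac(E[p^∞])) ⊆ (L_p^{BDP})`" at the trivial character [at a good ordinary `p > 3`, `K` with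
  (disc) `d_K` odd `≠ −3`, (Heeg) every `ℓ ∣ N` split, (spl) `p` split: Burungale–Castella–Skinner 2025
  Thm. 1.2.4 — EQUALITY, in `Λ⁻,ur ⊗ ℚ_p` under (irr_ℚ), integrally under (sur); at `p = 3`: Yan–Zhu
  2026 Thm. 4.12], composed with the BDP formula at `𝟙` [Cas18 Thm. 3.2 with `ε_p = p⁻¹` ⇐ BDP13 /
  Castella–Hsieh 2018; JSW17 §7.4.1 "`ord_p(L_p(f,1)) = 2·ord_p((1+p−a_p)/p · log_{ω_E}(z_K))`"
  (Brooks)]: `2·(ord_p log_ω P + ord_p(1 − a_p + p) − 1) ≤ ord_p f(0)` — PUBLISHED SHAPE on the locus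
  just named, every symbol a tree object; `IMCWaldspurgerOnTreeGoodAt` is its equality form.

Both are predicates WITH PARAMETERS (nothing asserted, consumed as hypotheses `hLC` / `hLA`, exactly
as multr1's): they are not Literature facts because `X_ac` is a Summits construction (no Literature
object for `X_Gr(E/K_∞⁻)` / `L_p^{BDP}` exists — lit-cgls sized ask S1).

## What is proved (every line the good-`p` twin of a multr1 theorem; proofs = valuation bookkeeping)

* `two_mul_index_le_of_onTreeGoodLowerLinks` — (IMC≥∘BDP)ᵍ + (CTL)ᵍ ⇒ `2·ord_p[E(K):ℤP] ≤
  ord_p #Ш(E/K)[p^∞] + ord_p ∏_{w∣N⁺} c_w(E/K)`: THE ANOMALY TERM `ord_p(1 − a_p + p)` CANCELS (it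
  enters both links — JSW17 §7.4.1, (eq:lowerbound-1) and the display after it, p. 30), so the output
  has the SAME shape as at a multiplicative prime, anomalous or not.
* `indexLowerBoundAt_of_onTreeGoodLowerLinks_of_heegner` — at a classical Heegner field (`K`
  imaginary quadratic, every `ℓ ∣ N_E` split), `p ≥ 5`, `Ш(E/K)` finite: STEP L `IndexLowerBoundAt W p
  K P` (Tamagawa steps = multr1's theorems `padicValNat_tamagawaProductSplit_eq_of_heegner`,
  `padicValNat_tamagawaProduct_baseChange_of_heegner`, JSW17 (eq:tamK));
  `indexIdentityAt_of_onTreeGoodLinks_of_heegner` — with the EQUALITY form, the Heegner-index IDENTITY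
  `X11b.IndexIdentityAt` (Gross–Zagier's conjecture V.(2.2) `p`-adically; the good-`p` irreducible twin
  of lit-cgls's `RowC6.indexIdentityAt_of_display55`);
  `imcLowerWaldspurgerOnTreeGoodAt_iff_indexLowerBoundAt` — given (CTL)ᵍ, STEP L at the datum is
  EXACTLY the one inequality (IMC≥∘BDP)ᵍ, no more.
* `indexLowerBoundAt_of_heegner_of_onTreeGoodLowerLinks` — finiteness of `Ш(E/K)` DISCHARGED
  (Gross–Zagier + Kolyvagin at the non-torsion Heegner point: multr1's `finite_sha_baseChange_of_heegner`);
  `indexLowerBoundAt_of_heegner_of_onTreeGoodInputs` — the links demanded, in route R1's idiom, for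
  EVERY anticyclotomic `ℤ_p`-extension `κ`, generator `γ`, degree-one `𝔭 ∋ p`, with THE embedding
  `embAt` (an anticyclotomic `κ`, a generator and a prime above `p` exist —
  `exists_anticyclotomic_generator_prime`; degree one because `p` SPLITS in `K`, here a HYPOTHESIS
  `SatisfiesHeegnerHypothesis p K` = (spl), at `p ∣ N` it came from (Heeg)).
The class-level consumers (rows C2 / C3-ord with the binder `hL` of gen 2 REPLACED by (`hLC`, `hLA`))
are in the companion `Partition/MainConjecturesAnticyclotomicGoodClass.lean`. `p = 3` (row C16) is
not reached here: the two Tamagawa transports are tree theorems for `p ≥ 5` only (lit-cgls S10).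

References: [Castella2018] Def. 2.2, Thm. 2.3 (arXiv:1704.06608 p. 5), Thm. 3.2 (p. 9), §5 (5.1)–(5.2)
(p. 12); [JetchevSkinnerWan2017] Thm. 3.3.1 (arXiv:1512.06894 p. 11), §3.5 (p. 16), §7.3.1 (eq:tamK),
§7.4.1 (eq:lowerbound-1)–(eq:shalowerK-1) (p. 30); [BurungaleCastellaSkinner2025] Thm. 1.2.2, 1.2.4,
Cor. 1.3.1 (proof) (arXiv:2405.00270v2 pp. 3–4); [YanZhu2024MainConjNonCM] Thm. 4.12, 4.15;
[BertoliniDarmonPrasanna2013] Thm. 5.13; [GrossLMS1991] Conj. (2.2), Thm. 1.3; [Kolyvagin1990] Thm. A;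
HOME/b2b-bsdres-lit-glue/GLUE.md §G2.2, §G2.4 (A4); CITED-FACTS.md C186.
-/

noncomputable section

open scoped Classical

open WeierstrassCurve NumberField IsDedekindDomain Literature.NumberTheory.EllipticCurves
  Literature.NumberTheory.EllipticCurves.ModularForms
  Literature.NumberTheory.EllipticCurves.Rank1Residual
  Summit.BirchSwinnertonDyer.Rank1Residual.X11b.AcSelmer

namespace Summit.BirchSwinnertonDyer.Rank1Residual.X11b

/-! ### The two links at a good ordinary prime, at a datum, every symbol a tree object -/

section Links

variable {W : WeierstrassCurve ℚ} [W.IsElliptic] [W.IsGloballyMinimal] {K : Type} [Field K]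
  [NumberField K]
variable (p : ℕ) [Fact p.Prime] (κ : ZpExtension K p) (𝔭 : HeightOneSpectrum (𝓞 K))
  (γ : Field.absoluteGaloisGroup K) [Fact (κ.IsTopGenerator γ)] (ι : K →+* ℚ_[p])

/-- **(CTL)ᵍ — the anticyclotomic control theorem at a GOOD ordinary `p` split in `K`, `Σ = ∅`, at
`P`, EVERY SYMBOL A TREE OBJECT — PUBLISHED SHAPE.** Castella, Camb. J. Math. 6 (2018) Thm. 2.3
(verbatim, arXiv:1704.06608 p. 5): "assume that `rank_ℤ(E(K)) = 1` and that `#Ш(E/K)[p^∞] < ∞`. Then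
`X_ac^Σ(E[p^∞])` is `Λ`-torsion, and letting `f_ac^Σ(T) ∈ Λ` be a generator of `Ch_Λ(X_ac^Σ(E[p^∞]))`,
we have `#ℤ_p/f_ac^Σ(0) = #Ш(E/K)[p^∞] · (#ℤ_p/((1 − a_p p⁻¹ + ε_p) log_{ω_E} P)/[E(K) ⊗ ℤ_p : ℤ_p.P])²
× ∏_{w∣N⁺, w∉Σ} c_w^{(p)}(E/K) · ∏_{w∈Σ} #H¹(K_w, E[p^∞])`, where `ε_p = p⁻¹` if `p ∤ N` and `ε_p = 0`
otherwise, `P ∈ E(K)` is any point of infinite order" — "this follows easily from the 'Anticyclotomic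
Control Theorem' established in [JSW]" = Jetchev–Skinner–Wan 2017 Thm. 3.3.1 (any level `N`; local
term at `v ∣ p`: `#ℤ_p/(((1−a_p+p)/p)·log_{ω_E} P)/[E(K):ℤ·P]_p`, §3.5). Read at `p ∤ N` (`ε_p = p⁻¹`,
`ord_p(1 − a_p p⁻¹ + p⁻¹) = ord_p(1 − a_p + p) − 1`, `a_p = W.frobeniusTrace p` on the globally minimal
model) and `Σ = ∅`, in valuations: the module `X_ac = AcSelmer.XAc (E_K) p κ 𝔭 ∅ γ` is torsion with a
generator `f`, `f(0) ≠ 0`, and `ord_p f(0) = ord_p #Ш(E/K)[p^∞] + 2·((ord_p log_ω P + ord_p(1 − a_p +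
p) − 1) − ord_p[E(K):ℤP]) + ord_p ∏_{w∣N⁺} c_w(E/K)`, with `ord_p log_ω P = padicLogOrd W p ι P` (`ι`
intended to be THE embedding `embAt K p 𝔭` at the strict prime) and `∏_{w∣N⁺} c_w = tamagawaProductSplit
W K`. The printed hypotheses (`rank E(K) = 1`, `#Ш(E/K)[p^∞] < ∞`, `P` of infinite order) are carried
by the consumer. `K_∞`-formulation of `X_ac` (Shapiro). The good-`p` twin of `ControlOnTreeAt`. A
predicate with parameters; nothing asserted; NOT a named fact (consumed as a hypothesis).
[cite: Castella2018, Thm. 2.3 (arXiv:1704.06608 p. 5) (shape only; nothing asserted)]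
[cite: JetchevSkinnerWan2017, Thm. 3.3.1 (arXiv:1512.06894 p. 11) and §3.5 (p. 16) (shape only; nothing asserted)] -/
def ControlOnTreeGoodAt (P : (W.baseChange K).toAffine.Point) : Prop :=
  ∃ n : ℕ, XAc.HasCharValuationAt (W.baseChange K) p κ 𝔭 ∅ γ n ∧
    (n : ℤ) = (padicValNat p (Nat.card (AddCommGroup.primaryComponent (W.baseChange K).sha p)) : ℤ) +
      2 * ((padicLogOrd W p ι P + (padicValInt p (1 - W.frobeniusTrace p + p) : ℤ) - 1) -
        (padicValNat p (AddSubgroup.zmultiples P).index : ℤ)) +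
        padicValNat p (tamagawaProductSplit W K)

/-- **(IMC≥) ∘ (BDP) at the trivial character at a GOOD ordinary `p` split in `K`, EVERY SYMBOL A TREE
OBJECT — PUBLISHED SHAPE on the locus named below.** The one-sided divisibility
"`Ch_Λ(X_ac(E[p^∞])) ⊆ (L_p^{BDP}(E/K))`" evaluated at `𝟙` — `ord_p L_p(𝟙) ≤ ord_p f_ac(0)` — composed
with the BDP `p`-adic Waldspurger formula at `𝟙`, Castella 2018 Thm. 3.2 (verbatim, arXiv:1704.06608
p. 9): "The following equality holds up to a `p`-adic unit: `L_p(f,𝟙) = (1 − a_p p⁻¹ + ε_p)² ·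
(log_{ω_E} P_K)²`, where `ε_p = p⁻¹` if `p ∤ N` and `ε_p = 0` otherwise, and `P_K ∈ E(K)` is a Heegner
point" ("This follows from [bdp1] and [cas-hsieh1] in the case `p ∤ N`"; Jetchev–Skinner–Wan 2017
§7.4.1, p. 30: "`ord_p(L_p(f,1)) = 2·ord_p((1+p−a_p)/p · log_{ω_E}(z_K))`"), read at `p ∤ N`:
`2·(ord_p log_ω P + ord_p(1 − a_p + p) − 1) ≤ ord_p f(0)` for a generator `f` (`f(0) ≠ 0`) of the
characteristic ideal of the constructed, `Λ`-torsion `X_ac = AcSelmer.XAc (E_K) p κ 𝔭 ∅ γ`; the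
unconstructed `L_p^{BDP}(𝟙)` is eliminated by the composition. IN PRINT at a good ordinary `p > 3` for
`K` with (disc) `d_K` odd `≠ −3`, (Heeg) every `ℓ ∣ N` split, (spl) `p` split: Burungale–Castella–
Skinner, IMRN 2025, Thm. 1.2.4 — the EQUALITY `ch(X_Gr(E/K_∞⁻)) = (L_p^{BDP}(E/K))`, in `Λ⁻,ur ⊗ ℚ_p`
under (irr_ℚ) and in `Λ⁻,ur` under (sur) (arXiv:2405.00270v2 p. 3); at `p = 3`: Yan–Zhu, J. Algebra
693 (2026) Thm. 4.12; these are the inputs of the printed proofs of BCS Cor. 1.3.1 / YZ Thm. 4.15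
(`r = 1`). The good-`p` twin of `IMCLowerWaldspurgerOnTreeAt`. A predicate with parameters; nothing
asserted; NOT a named fact (no Literature object for `X_Gr` / `L_p^{BDP}` exists yet — lit-cgls S1).
[cite: Castella2018, Thm. 3.2 (arXiv:1704.06608 p. 9) and §5 (5.1) (p. 12) (shape only; nothing asserted)]
[cite: BurungaleCastellaSkinner2025, Thm. 1.2.4 (arXiv:2405.00270v2 p. 3) (shape only; nothing asserted)]
[cite: JetchevSkinnerWan2017, §7.4.1 (eq:lowerbound-1) (arXiv:1512.06894 p. 30) (shape only; nothing asserted)] -/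
def IMCLowerWaldspurgerOnTreeGoodAt (P : (W.baseChange K).toAffine.Point) : Prop :=
  ∃ n : ℕ, XAc.HasCharValuationAt (W.baseChange K) p κ 𝔭 ∅ γ n ∧
    2 * (padicLogOrd W p ι P + (padicValInt p (1 - W.frobeniusTrace p + p) : ℤ) - 1) ≤ (n : ℤ)

/-- **(IMC) ∘ (BDP) at the trivial character at a GOOD ordinary `p`, the EQUALITY form, EVERY SYMBOL A
TREE OBJECT — PUBLISHED SHAPE** (BCS 2025 Thm. 1.2.4 (b) under (sur) / Yan–Zhu 2026 Thm. 4.12 under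
(Im), composed with Cas18 Thm. 3.2 with `ε_p = p⁻¹`): `ord_p f(0) = 2·(ord_p log_ω P + ord_p(1 − a_p +
p) − 1)` for a generator `f` of the characteristic ideal of the constructed `X_ac`. Castella §5
(eq:IMC+BDP) "`#ℤ_p/f_ac(0) = #ℤ_p/L_p(f,𝟙) = #(ℤ_p/(1 − a_p p⁻¹ + ε_p) log_{ω_E} P_K)²`" read at
`p ∤ N`. The good-`p` twin of `IMCWaldspurgerOnTreeAt`. A predicate with parameters; nothing asserted.
[cite: Castella2018, §5 (eq:IMC+BDP) (arXiv:1704.06608 p. 12) and Thm. 3.2 (p. 9) (shape only; nothing asserted)]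
[cite: BurungaleCastellaSkinner2025, Thm. 1.2.4 (b) (arXiv:2405.00270v2 p. 3) (shape only; nothing asserted)] -/
def IMCWaldspurgerOnTreeGoodAt (P : (W.baseChange K).toAffine.Point) : Prop :=
  ∃ n : ℕ, XAc.HasCharValuationAt (W.baseChange K) p κ 𝔭 ∅ γ n ∧
    (n : ℤ) = 2 * (padicLogOrd W p ι P + (padicValInt p (1 - W.frobeniusTrace p + p) : ℤ) - 1)

variable {p κ 𝔭 γ ι}

/-- The equality form implies the one-sided form (the two-sided main conjecture gives in particular
the divisibility consumed by STEP L). [folklore] -/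
theorem imcLowerWaldspurgerOnTreeGoodAt_of_imcWaldspurgerOnTreeGoodAt
    {P : (W.baseChange K).toAffine.Point} (h : IMCWaldspurgerOnTreeGoodAt p κ 𝔭 γ ι P) :
    IMCLowerWaldspurgerOnTreeGoodAt p κ 𝔭 γ ι P := by
  obtain ⟨n, hn, hne⟩ := h
  exact ⟨n, hn, le_of_eq hne.symm⟩

/-- **The anomaly term cancels: the Jetchev–Skinner–Wan LOWER BOUND on `Ш(E/K)` from the two
good-`p` tree-object links** — `2·ord_p[E(K):ℤP] ≤ ord_p #Ш(E/K)[p^∞] + ord_p ∏_{w∣N⁺} c_w(E/K)`,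
every symbol a tree object, no finiteness needed. JSW17 §7.4.1: (eq:lowerbound-1) `ord_p L_p(f,1) ≤
ord_p(#H¹_Sel · C)`, `ord_p L_p(f,1) = 2·ord_p((1+p−a_p)/p·log z_K)`, and `ord_p(#H¹_Sel · C) = ord_p #Ш
− 2·ord_p m_K + 2·ord_p((1+p−a_p)/p·log z_K) + ord_p ∏_{w∣N⁺} c_w` ⟹ (eq:shalowerK-1); here the two
generators' `ord_p f(0)` agree by `XAc.HasCharValuationAt.unique` and the rest is `omega`.
[cite: JetchevSkinnerWan2017, §7.4.1 (eq:lowerbound-1)–(eq:shalowerK-1) (arXiv:1512.06894 p. 30)]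
[cite: Castella2018, Thm. 2.3 (p. 5), Thm. 3.2 (p. 9)] -/
theorem two_mul_index_le_of_onTreeGoodLowerLinks {P : (W.baseChange K).toAffine.Point}
    (hIW : IMCLowerWaldspurgerOnTreeGoodAt p κ 𝔭 γ ι P) (hCTL : ControlOnTreeGoodAt p κ 𝔭 γ ι P) :
    2 * (padicValNat p (AddSubgroup.zmultiples P).index : ℤ) ≤
      (padicValNat p (Nat.card (AddCommGroup.primaryComponent (W.baseChange K).sha p)) : ℤ) +
        padicValNat p (tamagawaProductSplit W K) := by
  obtain ⟨n, hn, hle⟩ := hIW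
  obtain ⟨n', hn', hne'⟩ := hCTL
  obtain rfl : n = n' := hn.unique hn'
  omega

/-- **With the EQUALITY form, the Heegner-index identity over `K` in its `Λ`-adic shape**:
`ord_p #Ш(E/K)[p^∞] + ord_p ∏_{w∣N⁺} c_w(E/K) = 2·ord_p[E(K):ℤP]` (Castella's (5.2) = CGLS (5.5) read
at a good irreducible `p`; the anomaly term cancels). [cite: Castella2018, §5 (5.1)–(5.2) (arXiv:1704.06608 p. 12)] -/
theorem two_mul_index_eq_of_onTreeGoodLinks {P : (W.baseChange K).toAffine.Point}
    (hIW : IMCWaldspurgerOnTreeGoodAt p κ 𝔭 γ ι P) (hCTL : ControlOnTreeGoodAt p κ 𝔭 γ ι P) :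
    (padicValNat p (Nat.card (AddCommGroup.primaryComponent (W.baseChange K).sha p)) : ℤ) +
        padicValNat p (tamagawaProductSplit W K) =
      2 * (padicValNat p (AddSubgroup.zmultiples P).index : ℤ) := by
  obtain ⟨n, hn, hne⟩ := hIW
  obtain ⟨n', hn', hne'⟩ := hCTL
  obtain rfl : n = n' := hn.unique hn'
  omega

end Links

/-! ### At a classical Heegner field: STEP L, the index identity, and "STEP L ⟺ (IMC≥∘BDP)ᵍ" -/

section Heegner

variable {W : WeierstrassCurve ℚ} [W.IsElliptic] [W.IsGloballyMinimal] {p : ℕ} [Fact p.Prime]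
  {K : Type} [Field K] [NumberField K]

/-- **STEP L at a classical Heegner datum from the two good-`p` tree-object links** — for `W/ℚ`
globally minimal elliptic, `p ≥ 5`, `K` imaginary quadratic with every `ℓ ∣ N_E` split, `Ш(E/K)`
finite (Kolyvagin at a non-torsion Heegner point), the links (IMC≥∘BDP)ᵍ and (CTL)ᵍ at one
`(κ, γ, 𝔭, ι)` give `IndexLowerBoundAt W p K P` = the binder `hL` of
`bsdp_rankOne_of_indexLowerBoundAt_of_columnMainConjecture` AT THAT DATUM. The Tamagawa steps are
multr1's theorems: `ord_p ∏_{w∣N⁺} c_w = ord_p ∏_w c_w(E/K)` (`N⁺ = N`,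
`padicValNat_tamagawaProductSplit_eq_of_heegner`) and `ord_p ∏_w c_w(E/K) = 2·ord_p ∏_ℓ c_ℓ(E)`
(JSW17 (eq:tamK), `padicValNat_tamagawaProduct_baseChange_of_heegner`); `ord_p #Ш[p^∞] = ord_p #Ш`
for finite `Ш` (`padicValNat_card_addPrimaryComponent`). The good-`p` twin of
`indexLowerBoundAt_of_onTreeLowerLinks_of_heegner`.
[cite: JetchevSkinnerWan2017, §7.4.1 (eq:shalowerK-1) and §7.3.1 (eq:tamK) (arXiv:1512.06894 p. 30)]
[cite: Castella2018, (1.1) (p. 2), Thm. 2.3 (p. 5), Thm. 3.2 (p. 9)] -/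
theorem indexLowerBoundAt_of_onTreeGoodLowerLinks_of_heegner (hp : 5 ≤ p)
    (hK : IsImaginaryQuadratic K) {N : ℕ} (hN : W.conductorNorm ℤ = N)
    (hH : SatisfiesHeegnerHypothesis N K) {P : (W.baseChange K).toAffine.Point}
    [Finite (W.baseChange K).sha]
    {κ : ZpExtension K p} {𝔭 : HeightOneSpectrum (𝓞 K)} {γ : Field.absoluteGaloisGroup K}
    [Fact (κ.IsTopGenerator γ)] {ι : K →+* ℚ_[p]}
    (hIW : IMCLowerWaldspurgerOnTreeGoodAt p κ 𝔭 γ ι P) (hCTL : ControlOnTreeGoodAt p κ 𝔭 γ ι P) :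
    IndexLowerBoundAt W p K P := by
  haveI : Finite (AddCommGroup.primaryComponent (W.baseChange K).sha p) :=
    Finite.of_injective _ Subtype.val_injective
  have h := two_mul_index_le_of_onTreeGoodLowerLinks hIW hCTL
  rw [padicValNat_tamagawaProductSplit_eq_of_heegner W p K hp hK hN hH,
    padicValNat_tamagawaProduct_baseChange_of_heegner W p hp K hK hN hH,
    padicValNat_card_addPrimaryComponent] at h
  unfold IndexLowerBoundAt
  rw [WeierstrassCurve.shaOrder]
  omega

/-- **With the EQUALITY form: the Heegner-index IDENTITY over `K`** — `2·ord_p ∏_ℓ c_ℓ(E) + ord_p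
#Ш(E/K) = 2·ord_p[E(K):ℤP]` (`X11b.IndexIdentityAt W p K P`: Gross–Zagier's conjecture V.(2.2) /
Gross 1991 (2.2) `p`-adically, Castella's (5.3) at a field with every `ℓ ∣ N` split) from (IMC∘BDP)ᵍ
+ (CTL)ᵍ at a classical Heegner field, `p ≥ 5`, `Ш(E/K)` finite. The good-`p` IRREDUCIBLE twin of
lit-cgls's `RowC6.indexIdentityAt_of_display55` (CGLS 2022 (5.5) at a good Eisenstein `p`).
[cite: Castella2018, §5 (5.2)–(5.3) (arXiv:1704.06608 p. 12)] [cite: GrossLMS1991, §2 Conj. (2.2)] -/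
theorem indexIdentityAt_of_onTreeGoodLinks_of_heegner (hp : 5 ≤ p) (hK : IsImaginaryQuadratic K)
    {N : ℕ} (hN : W.conductorNorm ℤ = N) (hH : SatisfiesHeegnerHypothesis N K)
    {P : (W.baseChange K).toAffine.Point} [Finite (W.baseChange K).sha]
    {κ : ZpExtension K p} {𝔭 : HeightOneSpectrum (𝓞 K)} {γ : Field.absoluteGaloisGroup K}
    [Fact (κ.IsTopGenerator γ)] {ι : K →+* ℚ_[p]}
    (hIW : IMCWaldspurgerOnTreeGoodAt p κ 𝔭 γ ι P) (hCTL : ControlOnTreeGoodAt p κ 𝔭 γ ι P) :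
    IndexIdentityAt W p K P := by
  haveI : Finite (AddCommGroup.primaryComponent (W.baseChange K).sha p) :=
    Finite.of_injective _ Subtype.val_injective
  have h := two_mul_index_eq_of_onTreeGoodLinks hIW hCTL
  rw [padicValNat_tamagawaProductSplit_eq_of_heegner W p K hp hK hN hH,
    padicValNat_tamagawaProduct_baseChange_of_heegner W p hp K hK hN hH,
    padicValNat_card_addPrimaryComponent] at h
  unfold IndexIdentityAt
  rw [WeierstrassCurve.shaOrder]
  omega

/-- **Given (CTL)ᵍ, STEP L at the datum IS the one inequality (IMC≥∘BDP)ᵍ** (classical Heegner field,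
`p ≥ 5`, `Ш(E/K)` finite): so on the published control theorem the content of the typed input `hL` of
the gen-2 class theorems at a datum is EXACTLY "one divisibility of the anticyclotomic main conjecture
at one character, composed with BDP" — no more. The good-`p` twin of
`imcLowerAtTrivialChar_iff_indexLowerBoundAt`. Bookkeeping. [folklore] -/
theorem imcLowerWaldspurgerOnTreeGoodAt_iff_indexLowerBoundAt (hp : 5 ≤ p)
    (hK : IsImaginaryQuadratic K) {N : ℕ} (hN : W.conductorNorm ℤ = N)
    (hH : SatisfiesHeegnerHypothesis N K) {P : (W.baseChange K).toAffine.Point}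
    [Finite (W.baseChange K).sha]
    {κ : ZpExtension K p} {𝔭 : HeightOneSpectrum (𝓞 K)} {γ : Field.absoluteGaloisGroup K}
    [Fact (κ.IsTopGenerator γ)] {ι : K →+* ℚ_[p]} (hCTL : ControlOnTreeGoodAt p κ 𝔭 γ ι P) :
    IMCLowerWaldspurgerOnTreeGoodAt p κ 𝔭 γ ι P ↔ IndexLowerBoundAt W p K P := by
  refine ⟨fun h ↦ indexLowerBoundAt_of_onTreeGoodLowerLinks_of_heegner hp hK hN hH h hCTL, fun h ↦ ?_⟩
  haveI : Finite (AddCommGroup.primaryComponent (W.baseChange K).sha p) :=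
    Finite.of_injective _ Subtype.val_injective
  obtain ⟨n, hn, hne⟩ := hCTL
  refine ⟨n, hn, ?_⟩
  rw [padicValNat_tamagawaProductSplit_eq_of_heegner W p K hp hK hN hH,
    padicValNat_tamagawaProduct_baseChange_of_heegner W p hp K hK hN hH,
    padicValNat_card_addPrimaryComponent] at hne
  unfold IndexLowerBoundAt at h
  rw [WeierstrassCurve.shaOrder] at h
  omega

end Heegner

/-! ### The datum of the class theorems: finiteness discharged, the links in route R1's idiom -/

section Datum

variable (W : WeierstrassCurve ℚ) [W.IsElliptic] [W.IsGloballyMinimal] (p : ℕ) [Fact p.Prime]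
  (N : ℕ) [NeZero N] (K : Type) [Field K] [NumberField K]
  (Dt : ModularParametrizationData W N) (H : HeegnerDatum N (NumberField.discr K)) (ι : K →+* ℂ)
  (P : (W.baseChange K).toAffine.Point)

/-- **STEP L at a classical Heegner datum from the two good-`p` TREE-OBJECT links at one
`(κ, γ, 𝔭, ιp)`, finiteness of `Ш(E/K)` DISCHARGED** (Gross–Zagier `hGZ` + Kolyvagin `hKo` +
modularity `hmod` at the non-torsion Heegner point: multr1's `finite_sha_baseChange_of_heegner`): for
`p ≥ 5`, `ord_{s=1} L(E,s) = 1`, `K` imaginary quadratic with the Heegner hypothesis for `N = N_E`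
and `L(E^{d_K},1) ≠ 0`, `P` the Heegner point of `(Dt, H, ι)`. The good-`p` twin of
`indexLowerBoundAt_of_heegner_of_onTreeLowerLinks`.
[cite: JetchevSkinnerWan2017, §7.4.1 (eq:shalowerK-1) (arXiv:1512.06894 p. 30)]
[cite: Castella2018, Thm. 2.3 (p. 5), Thm. 3.2 (p. 9)] [cite: Kolyvagin1990, Thm. A] [cite: GrossLMS1991, Thm. 1.3] -/
theorem indexLowerBoundAt_of_heegner_of_onTreeGoodLowerLinks
    (hGZ : gross_zagier N W K) (hKo : kolyvagin N W K) (hmod : hasEntireLFunction_rat)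
    (hp : 5 ≤ p) (hr : W.analyticRank = 1) (hN : W.conductorNorm ℤ = N) (hK : IsImaginaryQuadratic K)
    (hHN : SatisfiesHeegnerHypothesis N K)
    (hLt : (W.quadraticTwist (NumberField.discr K : ℚ)).entireLFunction 1 ≠ 0)
    (hP : WeierstrassCurve.Affine.Point.map ι.toRatAlgHom P = heegnerPointComplex Dt H)
    {κ : ZpExtension K p} {𝔭 : HeightOneSpectrum (𝓞 K)} {γ : Field.absoluteGaloisGroup K}
    [Fact (κ.IsTopGenerator γ)] {ιp : K →+* ℚ_[p]}
    (hIW : IMCLowerWaldspurgerOnTreeGoodAt p κ 𝔭 γ ιp P) (hCTL : ControlOnTreeGoodAt p κ 𝔭 γ ιp P) :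
    IndexLowerBoundAt W p K P := by
  haveI : Finite (W.baseChange K).sha :=
    finite_sha_baseChange_of_heegner W N K Dt H ι P hGZ hKo hmod hr hK hHN hLt hP
  exact indexLowerBoundAt_of_onTreeGoodLowerLinks_of_heegner hp hK hN hHN hIW hCTL

/-- **STEP L at a classical Heegner datum from the good-`p` tree-object links in route R1's idiom** —
the links demanded for EVERY anticyclotomic `ℤ_p`-extension `κ` of `K`, topological generator `γ`
and degree-one prime `𝔭 ∋ p` of `𝓞_K`, with THE embedding `embAt K p 𝔭 : K ↪ K_𝔭 = ℚ_p`. An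
anticyclotomic `κ`, a generator and a prime above `p` exist (`exists_anticyclotomic_generator_prime`:
global reciprocity); the prime has degree one because `p` SPLITS in `K` — here the HYPOTHESIS
`SatisfiesHeegnerHypothesis p K` (= (spl) of BCS Thm. 1.2.4 / Cas18 §2.1 / JSW (split)), whereas at
`p ∣ N` it came from the Heegner hypothesis. The good-`p` twin of
`indexLowerBoundAt_of_heegner_of_onTreeInputs`.
[cite: JetchevSkinnerWan2017, §7.4.1 (eq:shalowerK-1) (arXiv:1512.06894 p. 30)]
[cite: Castella2018, §2.1 ("`p = 𝔭𝔭̄` splits"), Thm. 2.3 (p. 5), Thm. 3.2 (p. 9)]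
[cite: BurungaleCastellaSkinner2025, Thm. 1.2.4, hypotheses (Heeg), (spl) (arXiv:2405.00270v2 p. 3)] -/
theorem indexLowerBoundAt_of_heegner_of_onTreeGoodInputs
    (hGZ : gross_zagier N W K) (hKo : kolyvagin N W K) (hmod : hasEntireLFunction_rat)
    (hp : 5 ≤ p) (hr : W.analyticRank = 1) (hN : W.conductorNorm ℤ = N)
    (hK : IsImaginaryQuadratic K) (hHN : SatisfiesHeegnerHypothesis N K)
    (hHp : SatisfiesHeegnerHypothesis p K)
    (hLt : (W.quadraticTwist (NumberField.discr K : ℚ)).entireLFunction 1 ≠ 0)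
    (hP : WeierstrassCurve.Affine.Point.map ι.toRatAlgHom P = heegnerPointComplex Dt H)
    (hC : ∀ (κ : ZpExtension K p), κ.IsAnticyclotomic →
      ∀ (γ : Field.absoluteGaloisGroup K) [Fact (κ.IsTopGenerator γ)] (𝔭 : HeightOneSpectrum (𝓞 K))
        (h𝔭 : ((p : ℕ) : 𝓞 K) ∈ 𝔭.asIdeal) (he : 𝔭.asIdeal.ramificationIdx (𝓞 ℚ) = 1)
        (hf : 𝔭.asIdeal.inertiaDeg (𝓞 ℚ) = 1),
        ControlOnTreeGoodAt p κ 𝔭 γ (embAt K p 𝔭 h𝔭 he hf) P)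
    (hA : ∀ (κ : ZpExtension K p), κ.IsAnticyclotomic →
      ∀ (γ : Field.absoluteGaloisGroup K) [Fact (κ.IsTopGenerator γ)] (𝔭 : HeightOneSpectrum (𝓞 K))
        (h𝔭 : ((p : ℕ) : 𝓞 K) ∈ 𝔭.asIdeal) (he : 𝔭.asIdeal.ramificationIdx (𝓞 ℚ) = 1)
        (hf : 𝔭.asIdeal.inertiaDeg (𝓞 ℚ) = 1),
        IMCLowerWaldspurgerOnTreeGoodAt p κ 𝔭 γ (embAt K p 𝔭 h𝔭 he hf) P) :
    IndexLowerBoundAt W p K P := by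
  have hsplit : SplitsIn K p := hHp p Fact.out (dvd_refl p)
  obtain ⟨κ, γ, 𝔭, hκ, hγ, h𝔭⟩ := exists_anticyclotomic_generator_prime (p := p) hK
  haveI : Fact (κ.IsTopGenerator γ) := ⟨hγ⟩
  obtain ⟨he, hf⟩ := degreeOne_of_splitsIn hK.1 hsplit h𝔭
  exact indexLowerBoundAt_of_heegner_of_onTreeGoodLowerLinks W p N K Dt H ι P hGZ hKo hmod hp hr hN hK
    hHN hLt hP (hA κ hκ γ 𝔭 h𝔭 he hf) (hC κ hκ γ 𝔭 h𝔭 he hf)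

/-- **Non-vacuity of the quantifier domain**: at the data of the class theorems (`K` imaginary
quadratic with `p` split) an anticyclotomic `ℤ_p`-extension `κ`, a topological generator `γ` and a
DEGREE-ONE prime `𝔭 ∋ p` EXIST — so the binders `hLC` / `hLA` of the companion class theorems are
demanded at existing data, not vacuously. [cite: GreenbergLNM1716, §1 (the anticyclotomic `ℤ_p`-extension)] -/
theorem exists_anticyclotomic_generator_degreeOnePrime (hK : IsImaginaryQuadratic K)
    (hHp : SatisfiesHeegnerHypothesis p K) :
    ∃ (κ : ZpExtension K p) (γ : Field.absoluteGaloisGroup K) (𝔭 : HeightOneSpectrum (𝓞 K)),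
      κ.IsAnticyclotomic ∧ κ.IsTopGenerator γ ∧ ((p : ℕ) : 𝓞 K) ∈ 𝔭.asIdeal ∧
        𝔭.asIdeal.ramificationIdx (𝓞 ℚ) = 1 ∧ 𝔭.asIdeal.inertiaDeg (𝓞 ℚ) = 1 := by
  have hsplit : SplitsIn K p := hHp p Fact.out (dvd_refl p)
  obtain ⟨κ, γ, 𝔭, hκ, hγ, h𝔭⟩ := exists_anticyclotomic_generator_prime (p := p) hK
  obtain ⟨he, hf⟩ := degreeOne_of_splitsIn hK.1 hsplit h𝔭
  exact ⟨κ, γ, 𝔭, hκ, hγ, h𝔭, he, hf⟩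

end Datum

end Summit.BirchSwinnertonDyer.Rank1Residual.X11b

end
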